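import Summits.Ventures.HodgeRepro2.T5FinitePlaceSplitIff

/-!
# The product decomposition at a split place: `K⁺_v ⊗_{K⁺} K ≃ₐ[K⁺_v] K_w × K_{w'}` (cell pub-hodge-repro2, seat p3)

Tier-5 N2 support, §N2.9.2 of route/T5-N2-route-3.md («completions») at the finite places — the ONE map that
§59(c) of T5-SUPPORT-p3.md left to a consumer, at a SPLIT place of the CM field: for two distinct primes `w ≠ w'`
of `K` above `v` (the split case, `θ` a `v`-adic square), the product of the two tensor lifts
`prodLift : K⁺_v ⊗[K⁺] K →ₐ[K⁺_v] K_w × K_{w'}` is an isomorphism (`prodLiftEquiv`). Surjectivity is WEAK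
APPROXIMATION for the two places, obtained from the Chinese remainder theorem in `𝓞_K` (`exists_crt`: `x ≡ 1 mod wⁿ`,
`x ≡ 0 mod w'ⁿ`) and the closedness of the finite-dimensional image (`prodLift_surjective`); injectivity is the
dimension count `2 = 1 + 1` (file 126: `K_w = K⁺_v` at a split place). With file 117's
`tensorLiftEquivOfNotIsSquare` at the non-split places, §N2.9.2's identification `K ⊗_{K⁺} K⁺_v ≅ ∏_{w ∣ v} K_w`
is an explicit `K⁺_v`-algebra isomorphism at every finite place `v` of `K⁺`.
Mathlib + files 115–126 only. No display; no device. §8(d): uses an L-value-free non-vanishing device: NO.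
-/

namespace Summit.Ventures.HodgeRepro2.T5FinitePlaceSplitProduct

open IsDedekindDomain IsDedekindDomain.HeightOneSpectrum NumberField NumberField.IsCMField Module WithZero Topology
open scoped Summit.Ventures.HodgeRepro2.T5FinitePlaceLiesOver TensorProduct Valued
open Summit.Ventures.HodgeRepro2.T5FinitePlaceLiesOver Summit.Ventures.HodgeRepro2.T5FinitePlaceCM
  Summit.Ventures.HodgeRepro2.T5FinitePlaceCMDecomp Summit.Ventures.HodgeRepro2.T5FinitePlaceSplitIff

section CRT

variable {K : Type*} [Field K] [NumberField K]

/-- **Chinese remainder:** for distinct primes `w ≠ w'` of `𝓞_K` and `n`, some `x ∈ 𝓞_K` has `x ≡ 1 (mod wⁿ)` and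
`x ≡ 0 (mod w'ⁿ)`. -/
theorem exists_crt (w w' : HeightOneSpectrum (𝓞 K)) (hne : w ≠ w') (n : ℕ) :
    ∃ x : 𝓞 K, x - 1 ∈ w.asIdeal ^ n ∧ x ∈ w'.asIdeal ^ n := by
  have key : ∀ {a b : HeightOneSpectrum (𝓞 K)}, a ≠ b → a.asIdeal ≠ b.asIdeal :=
    fun hab hab' => hab (HeightOneSpectrum.ext hab')
  obtain ⟨y, hy⟩ := IsDedekindDomain.exists_forall_sub_mem_ideal (s := (Finset.univ : Finset (Fin 2)))
    (fun i => (![w, w'] i).asIdeal) (fun _ => n) (fun i _ => (![w, w'] i).prime)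
    (fun i _ j _ hij h => by
      fin_cases i <;> fin_cases j
      · exact hij rfl
      · exact key hne h
      · exact key hne.symm h
      · exact hij rfl)
    (fun i => ![(1 : 𝓞 K), 0] i.1)
  refine ⟨y, ?_, ?_⟩
  · simpa using hy 0 (Finset.mem_univ _)
  · simpa using hy 1 (Finset.mem_univ _)

end CRT

section Split

variable (K : Type*) [Field K] [NumberField K] [IsCMField K]
variable (v : HeightOneSpectrum (𝓞 (maximalRealSubfield K))) (w w' : HeightOneSpectrum (𝓞 K))
  [w.asIdeal.LiesOver v.asIdeal] [w'.asIdeal.LiesOver v.asIdeal]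

/-- The product of the two tensor lifts, `K⁺_v ⊗[K⁺] K →ₐ[K⁺_v] K_w × K_{w'}`. -/
noncomputable def prodLift :
    (v.adicCompletion (maximalRealSubfield K)) ⊗[maximalRealSubfield K] K →ₐ[v.adicCompletion (maximalRealSubfield K)]
      (w.adicCompletion K × w'.adicCompletion K) :=
  (tensorLift v w).prod (tensorLift v w')

omit [IsCMField K] in
/-- `prodLift (1 ⊗ x) = (x, x)`. -/
theorem prodLift_one_tmul (x : K) :
    prodLift K v w w' (1 ⊗ₜ x) = (algebraMap K (w.adicCompletion K) x, algebraMap K (w'.adicCompletion K) x) := by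
  simp [prodLift, tensorLift_tmul]

omit [IsCMField K] in
/-- `prodLift (a ⊗ 1) = (a, a)`. -/
theorem prodLift_tmul_one (a : v.adicCompletion (maximalRealSubfield K)) :
    prodLift K v w w' (a ⊗ₜ 1) =
      (algebraMap (v.adicCompletion (maximalRealSubfield K)) (w.adicCompletion K) a,
        algebraMap (v.adicCompletion (maximalRealSubfield K)) (w'.adicCompletion K) a) := by
  simp [prodLift, tensorLift_tmul]

omit [IsCMField K] in
/-- The valuation of `x − 1` at `w` for `x ≡ 1 (mod wⁿ)`. -/
theorem valued_algebraMap_sub_one_le {x : 𝓞 K} {n : ℕ} (hx : x - 1 ∈ w.asIdeal ^ n) :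
    Valued.v (algebraMap K (w.adicCompletion K) (algebraMap (𝓞 K) K x) - 1) ≤ exp (-(n : ℤ)) := by
  have h : algebraMap K (w.adicCompletion K) (algebraMap (𝓞 K) K x) - 1 =
      algebraMap K (w.adicCompletion K) (algebraMap (𝓞 K) K (x - 1)) := by
    rw [map_sub, map_sub, map_one, map_one]
  rw [h, show algebraMap K (w.adicCompletion K) (algebraMap (𝓞 K) K (x - 1)) =
      ((algebraMap (𝓞 K) K (x - 1) : K) : w.adicCompletion K) from rfl,
    adicCompletion.valued_coe, valuation_of_algebraMap]
  exact (w.intValuation_le_pow_iff_mem _ n).mpr hx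

omit [IsCMField K] in
/-- The valuation of `x` at `w'` for `x ≡ 0 (mod w'ⁿ)`. -/
theorem valued_algebraMap_le {x : 𝓞 K} {n : ℕ} (hx : x ∈ w'.asIdeal ^ n) :
    Valued.v (algebraMap K (w'.adicCompletion K) (algebraMap (𝓞 K) K x)) ≤ exp (-(n : ℤ)) := by
  rw [show algebraMap K (w'.adicCompletion K) (algebraMap (𝓞 K) K x) =
      ((algebraMap (𝓞 K) K x : K) : w'.adicCompletion K) from rfl, adicCompletion.valued_coe,
    valuation_of_algebraMap]
  exact (w'.intValuation_le_pow_iff_mem _ n).mpr hx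

/-- A valuation ball around `z` is a neighbourhood that contains a ball of radius `exp (−n)` for some `n`. -/
theorem exists_exp_neg_lt_of_mem_nhds {R : Type*} [Field R] [Valued R ℤᵐ⁰] {z : R} {U : Set R} (hU : U ∈ 𝓝 z) :
    ∃ n : ℕ, ∀ y : R, Valued.v (y - z) ≤ exp (-(n : ℤ)) → y ∈ U := by
  obtain ⟨γ, hγ⟩ := Valued.mem_nhds.mp hU
  have h0 : Valued.v (z - z) < _ :=
    (Valuation.restrict_lt_iff_lt_embedding (v := (Valued.v : Valuation R ℤᵐ⁰))).mp
      (by rw [sub_self, map_zero]; exact Units.zero_lt γ)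
  rw [sub_self, map_zero] at h0
  obtain ⟨n, hn⟩ := exists_exp_neg_natCast_lt h0.ne'
  refine ⟨n, fun y hy => hγ ?_⟩
  show Valued.v.restrict (y - z) < (γ : _)
  rw [Valuation.restrict_lt_iff_lt_embedding]
  exact lt_of_le_of_lt hy hn

variable {θ : maximalRealSubfield K} {y : K}
variable (hθ : algebraMap (maximalRealSubfield K) K θ = y ^ 2) (hy : complexConj K y ≠ y)

omit [IsCMField K] in
/-- **Weak approximation at two places, from the Chinese remainder theorem:** the image of `prodLift` contains
`(1, 0)`. -/
theorem one_zero_mem_range (hne : w ≠ w') : ((1 : w.adicCompletion K), (0 : w'.adicCompletion K)) ∈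
    LinearMap.range (prodLift K v w w').toLinearMap := by
  have hcl : IsClosed ((LinearMap.range (prodLift K v w w').toLinearMap :
      Submodule (v.adicCompletion (maximalRealSubfield K)) (w.adicCompletion K × w'.adicCompletion K)) :
      Set (w.adicCompletion K × w'.adicCompletion K)) :=
    Submodule.closed_of_finiteDimensional (𝕜 := v.adicCompletion (maximalRealSubfield K)) _
  rw [← SetLike.mem_coe, ← hcl.closure_eq, mem_closure_iff_nhds]
  intro U hU
  obtain ⟨U₁, hU₁, U₂, hU₂, hsub⟩ := mem_nhds_prod_iff.mp hU
  obtain ⟨n₁, hn₁⟩ := exists_exp_neg_lt_of_mem_nhds hU₁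
  obtain ⟨n₂, hn₂⟩ := exists_exp_neg_lt_of_mem_nhds hU₂
  obtain ⟨x, hx1, hx2⟩ := exists_crt w w' hne (max n₁ n₂)
  refine ⟨prodLift K v w w' (1 ⊗ₜ algebraMap (𝓞 K) K x), hsub ⟨?_, ?_⟩, ⟨_, rfl⟩⟩
  · rw [prodLift_one_tmul]
    apply hn₁
    refine (valued_algebraMap_sub_one_le K w hx1).trans (exp_le_exp.mpr ?_)
    have := le_max_left n₁ n₂
    omega
  · rw [prodLift_one_tmul]
    apply hn₂
    rw [sub_zero]
    refine (valued_algebraMap_le K w' hx2).trans (exp_le_exp.mpr ?_)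
    have := le_max_right n₁ n₂
    omega

omit [IsCMField K] in
/-- The image of `prodLift` contains `(1, 1)` and hence `(0, 1)`. -/
theorem zero_one_mem_range (hne : w ≠ w') : ((0 : w.adicCompletion K), (1 : w'.adicCompletion K)) ∈
    LinearMap.range (prodLift K v w w').toLinearMap := by
  have h11 : ((1 : w.adicCompletion K), (1 : w'.adicCompletion K)) ∈
      LinearMap.range (prodLift K v w w').toLinearMap :=
    ⟨1 ⊗ₜ 1, by rw [AlgHom.toLinearMap_apply, prodLift_one_tmul, map_one, map_one]⟩
  have := Submodule.sub_mem _ h11 (one_zero_mem_range K v w w' hne)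
  simpa using this

include hθ hy in
/-- **`prodLift` is surjective at a split place** (`K_w = K⁺_v = K_{w'}` and `(1,0), (0,1)` are in the image). -/
theorem prodLift_surjective (hne : w ≠ w')
    (hsq : IsSquare (algebraMap (maximalRealSubfield K) (v.adicCompletion (maximalRealSubfield K)) θ)) :
    Function.Surjective (prodLift K v w w') := by
  have hw := Algebra.finrank_eq_one_iff_bijective_algebraMap.mp (finrank_eq_one_of_isSquare K hθ hy v w hsq)
  have hw' := Algebra.finrank_eq_one_iff_bijective_algebraMap.mp (finrank_eq_one_of_isSquare K hθ hy v w' hsq)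
  rintro ⟨a, b⟩
  obtain ⟨a₀, rfl⟩ := hw.2 a
  obtain ⟨b₀, rfl⟩ := hw'.2 b
  have h1 := Submodule.smul_mem _ a₀ (one_zero_mem_range K v w w' hne)
  have h2 := Submodule.smul_mem _ b₀ (zero_one_mem_range K v w w' hne)
  have h := Submodule.add_mem _ h1 h2
  obtain ⟨z, hz⟩ := h
  refine ⟨z, ?_⟩
  rw [AlgHom.toLinearMap_apply] at hz
  rw [hz, Prod.smul_mk, Prod.smul_mk, Prod.mk_add_mk, smul_zero, smul_zero, add_zero, zero_add,
    Algebra.smul_def, mul_one, Algebra.smul_def, mul_one]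

include hθ hy in
/-- **`prodLift` is bijective at a split place** (dimension count `2 = 1 + 1`). -/
theorem prodLift_bijective (hne : w ≠ w')
    (hsq : IsSquare (algebraMap (maximalRealSubfield K) (v.adicCompletion (maximalRealSubfield K)) θ)) :
    Function.Bijective (prodLift K v w w') := by
  haveI := finite v w
  haveI := finite v w'
  refine ⟨?_, prodLift_surjective K v w w' hθ hy hne hsq⟩
  have hfin : finrank (v.adicCompletion (maximalRealSubfield K))
      ((v.adicCompletion (maximalRealSubfield K)) ⊗[maximalRealSubfield K] K) =
      finrank (v.adicCompletion (maximalRealSubfield K)) (w.adicCompletion K × w'.adicCompletion K) := by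
    rw [Module.finrank_baseChange, Module.finrank_prod, finrank_eq_one_of_isSquare K hθ hy v w hsq,
      finrank_eq_one_of_isSquare K hθ hy v w' hsq, Algebra.IsQuadraticExtension.finrank_eq_two]
  exact (LinearMap.injective_iff_surjective_of_finrank_eq_finrank (f := (prodLift K v w w').toLinearMap) hfin).mpr
    (prodLift_surjective K v w w' hθ hy hne hsq)

/-- **THE PRODUCT DECOMPOSITION AT A SPLIT PLACE:** `K⁺_v ⊗[K⁺] K ≃ₐ[K⁺_v] K_w × K_{w'}`. -/
noncomputable def prodLiftEquiv (hne : w ≠ w')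
    (hsq : IsSquare (algebraMap (maximalRealSubfield K) (v.adicCompletion (maximalRealSubfield K)) θ)) :
    (v.adicCompletion (maximalRealSubfield K)) ⊗[maximalRealSubfield K] K ≃ₐ[v.adicCompletion (maximalRealSubfield K)]
      (w.adicCompletion K × w'.adicCompletion K) :=
  AlgEquiv.ofBijective (prodLift K v w w') (prodLift_bijective K v w w' hθ hy hne hsq)

/-- `prodLiftEquiv (1 ⊗ x) = (x, x)`. -/
theorem prodLiftEquiv_one_tmul (hne : w ≠ w')
    (hsq : IsSquare (algebraMap (maximalRealSubfield K) (v.adicCompletion (maximalRealSubfield K)) θ)) (x : K) :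
    prodLiftEquiv K v w w' hθ hy hne hsq (1 ⊗ₜ x) =
      (algebraMap K (w.adicCompletion K) x, algebraMap K (w'.adicCompletion K) x) :=
  prodLift_one_tmul K v w w' x

end Split

end Summit.Ventures.HodgeRepro2.T5FinitePlaceSplitProduct
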